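import Literature.Geometry.Riemannian.GreatSphereFibrations

/-!
# Great 3-sphere fibrations of `S⁷` (Yang 1981) — proofs and counterexample data

Companion to `Literature.Geometry.Riemannian.GreatSphereFibrations` (named fact
`Yang1981_greatSphereFibration`, Yang 1981 Thm. 2 / Thm. 4 / Cor. 4 for `n = 4`).

The discharge `Yang1981_greatSphereFibration_holds` is **not** provided: reading the source shows that
the conclusion of the named fact (the transported second chart `φ₁ = λ_u ∘ ψ`, a diffeomorphism onto
`ℝ⁴` with `φ₁ x_∞ = 0`) forces the division algebra `m` to be isotopic — hence, being unital, isomorphic —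
to the quaternions, so that the fact is equivalent to "every smooth great 3-sphere fibration of `S⁷` is
fibrewise diffeomorphic to the Hopf fibration", which implies that every base is diffeomorphic to `S⁴`.
That statement IS proved in print — Hähl 1987, Thm. 1.3 (`n = 4`; proof §4.8: the base is a twisted
sphere, Prop. 4.7, hence `≅ S⁴` by Cerf's `Γ₄ = 0`) — but not in Yang 1981, and its Lean discharge would
need Cerf's theorem; see the Status section of the module docstring of
`Literature.Geometry.Riemannian.GreatSphereFibrations`. The printed proof of Thm. 2 contains the gap
recorded below; the resulting refutation of Thm. 2 as printed is published as Grundhöfer–Hähl 1990,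
Thm. 1.3 ("the fibration determined by a real division algebra `D` … is a differentiable locally
trivial fiber bundle if and only if `D` is isomorphic to `ℝ`, `ℂ`, `ℍ` or `𝕆`"; p. 357: "his proof
contains a fallacy (see [9, 2.10])", i.e. Hähl 1987, Rem. 2.10), by the same mechanism (homogeneity
plus differentiability at the fibre `{w = 0}` forces linearity, proof of their Thm. 1.3, p. 359). This
file vendors the elementary, kernel-checkable part of that analysis: explicit non-additive witnesses.

## References

* [Yang1981] C. T. Yang, *Division algebras and fibrations of spheres by great spheres*,
  J. Differential Geom. 16 (1981) 577–593, Thm. 2 and its proof, p. 580–581 (read in the reprint,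
  *Mathematical Essays in honor of Su Buchin*, World Scientific).
* [GrundhoferHahl1990] T. Grundhöfer, H. Hähl, *Fibrations of spheres by great spheres over division
  algebras and their differentiability*, J. Differential Geom. 31 (1990) 357–363, §0 and Thm. 1.3.
* [Hahl1987] H. Hähl, *Differentiable fibrations of the (2n-1)-sphere by great (n-1)-spheres and their
  coordinatization over quasifields*, Results Math. 12 (1987) 99–118, Thm. 1.3, Rem. 2.10, §4.8.
-/

noncomputable section

namespace Literature.Geometry.Riemannian

/-! ### The printed Theorem 2 fails for a non-quaternionic division algebra (counterexample data)

Yang's proof of Thm. 2 (p. 581) asserts that `g₁(u, v) = (u, λ_u(v))/√(1 + |λ_u(v)|²)` is "a smooth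
imbedding" near `v = ∞` and that the smooth structure `{id_K, λ_u}` on `Σ_K` "is independent of the
choice of `u`". Both require the composite `w ↦ z`, where `m(v, w) = u'` and `m(v, z) = u` — i.e.
`z = λ_u(π_K(u', w))`, the second chart of `Σ_K` read along the slice `fstHalf = u'` of `S⁷` near the
fibre `{w = 0}` — to be smooth at `w = 0` (with value `λ_u(∞) = 0`). By bilinearity this composite is
homogeneous of degree `1` in `w` (`Yang1981_lambdaChart_homogeneous`), so differentiability at `0`
forces it to be *additive* in `w`. For the mutation `m(a, b) = 2ab - ba` of the quaternion product — a
division algebra in Yang's sense (identity `1`; no zero divisors because `‖2ab‖ = 2‖ba‖ ≠ ‖ba‖`) —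
additivity fails: `Yang1981_lambdaChart_not_additive` records exact witnesses (`u = e`, `u' = j`,
`w = i, j, i + j` give `z = -3k, 1, (9 - 3k)/5`). Hence for this `K` the partition of `S⁷` in Thm. 2 is
not a smooth fibration for the atlas of Thm. 2 (in fact for no smooth structure on the base: its set of
fibres has a conic singularity in `G₄(ℝ⁸)` at `{w = 0}`), and the transported chart `φ₁` in
`Yang1981_greatSphereFibration` can exist only when `m` is isotopic to `ℍ`. The named fact above is
therefore equivalent to the statement that every smooth great 3-sphere fibration of `S⁷` is fibrewise
diffeomorphic to the Hopf fibration (proved: Hähl 1987, Thm. 1.3, via Cerf's `Γ₄ = 0`; not proved in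
Yang 1981); it is kept verbatim as the transcription of the printed claims.
[cite: Yang1981, Thm. 2, p. 581; GrundhoferHahl1990, Thm. 1.3 (the published refutation)]
-/

section MutationCounterexample

open Quaternion

/-- Degree-one homogeneity of Yang's second chart along a slice: if `m(v, w) = u'` and `m(v, z) = u`
then `m(t⁻¹v, tw) = u'` and `m(t⁻¹v, tz) = u` (`t ≠ 0`), i.e. `λ_u(π_K(u', t w)) = t · λ_u(π_K(u', w))`
whenever the solutions are unique (regular `m`). [cite: Yang1981, Thm. 2, p. 581] -/
theorem Yang1981_lambdaChart_homogeneous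
    (m : EuclideanSpace ℝ (Fin 4) →ₗ[ℝ] EuclideanSpace ℝ (Fin 4) →ₗ[ℝ] EuclideanSpace ℝ (Fin 4))
    {v w z u u' : EuclideanSpace ℝ (Fin 4)} {t : ℝ} (ht : t ≠ 0)
    (hw : m v w = u') (hz : m v z = u) :
    m (t⁻¹ • v) (t • w) = u' ∧ m (t⁻¹ • v) (t • z) = u := by
  constructor <;>
    simp [map_smul, LinearMap.smul_apply, smul_smul, mul_inv_cancel₀ ht, hw, hz]

/-- **Counterexample to the smoothness claim in the printed proof of Yang's Thm. 2 (n = 4).**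
There is a division algebra `(ℝ⁴, m, e)` in Yang's sense (the mutation `2ab - ba` of the quaternion
product, transported along `Quaternion.linearIsometryEquivTuple`) and `u' ≠ 0`, `w₁, w₂ ≠ 0` with
`w₁ + w₂ ≠ 0`, such that the (unique, by regularity) solutions of `m(v, w) = u'`, `m(v, z) = e` for
`w = w₁, w₂, w₁ + w₂` satisfy `z₁ + z₂ ≠ z₁₂`: the second-chart composite `w ↦ λ_e(π_K(u', w))` of
Thm. 2 is not additive, hence (being homogeneous of degree one, `Yang1981_lambdaChart_homogeneous`)
not differentiable at `w = 0`, contrary to "g₁ is a smooth imbedding" (p. 581).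
[cite: Yang1981, Thm. 2, p. 581] -/
theorem Yang1981_lambdaChart_not_additive :
    ∃ (m : EuclideanSpace ℝ (Fin 4) →ₗ[ℝ] EuclideanSpace ℝ (Fin 4) →ₗ[ℝ] EuclideanSpace ℝ (Fin 4))
      (e : EuclideanSpace ℝ (Fin 4)), IsDivisionAlg m e ∧
      ∃ (u' w₁ w₂ v₁ v₂ v₁₂ z₁ z₂ z₁₂ : EuclideanSpace ℝ (Fin 4)),
        u' ≠ 0 ∧ w₁ ≠ 0 ∧ w₂ ≠ 0 ∧ w₁ + w₂ ≠ 0 ∧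
        m v₁ w₁ = u' ∧ m v₁ z₁ = e ∧
        m v₂ w₂ = u' ∧ m v₂ z₂ = e ∧
        m v₁₂ (w₁ + w₂) = u' ∧ m v₁₂ z₁₂ = e ∧
        z₁ + z₂ ≠ z₁₂ := by
  -- the linear isometry `ℍ ≃ ℝ⁴` and the transported mutation product `2ab - ba`
  set T : ℍ ≃ₗ[ℝ] EuclideanSpace ℝ (Fin 4) := Quaternion.linearIsometryEquivTuple.toLinearEquiv
    with hT
  set μ : ℍ →ₗ[ℝ] ℍ →ₗ[ℝ] ℍ := (2 : ℝ) • LinearMap.mul ℝ ℍ - (LinearMap.mul ℝ ℍ).flip with hμ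
  have hμapp : ∀ a b : ℍ, μ a b = (2 : ℝ) • (a * b) - b * a := by
    intro a b; simp [hμ]
  set m : EuclideanSpace ℝ (Fin 4) →ₗ[ℝ] EuclideanSpace ℝ (Fin 4) →ₗ[ℝ] EuclideanSpace ℝ (Fin 4) :=
    (μ.compl₁₂ T.symm.toLinearMap T.symm.toLinearMap).compr₂ T.toLinearMap with hm
  have hmapp' : ∀ x y, m x y = T ((2 : ℝ) • (T.symm x * T.symm y) - T.symm y * T.symm x) := by
    intro x y; simp [hm, hμapp]
  have hmapp : ∀ a b : ℍ, m (T a) (T b) = T ((2 : ℝ) • (a * b) - b * a) := by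
    intro a b; simp [hmapp']
  -- no zero divisors: `2va = av ⇒ v = 0` and `2aw = wa ⇒ w = 0` for `a ≠ 0`
  have key : ∀ a v : ℍ, a ≠ 0 → (2 : ℝ) • (v * a) - a * v = 0 → v = 0 := by
    intro a v ha h
    have h1 : ‖(2 : ℝ) • (v * a)‖ = ‖a * v‖ := by rw [sub_eq_zero.1 h]
    rw [norm_smul, norm_mul, norm_mul, Real.norm_ofNat] at h1
    have ha' : 0 < ‖a‖ := norm_pos_iff.2 ha
    have h2 : ‖v‖ * ‖a‖ = 0 := by nlinarith [norm_nonneg v]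
    rcases mul_eq_zero.1 h2 with h3 | h3
    · exact norm_eq_zero.1 h3
    · exact absurd h3 ha'.ne'
  have key' : ∀ a w : ℍ, a ≠ 0 → (2 : ℝ) • (a * w) - w * a = 0 → w = 0 := by
    intro a w ha h
    have h1 : ‖(2 : ℝ) • (a * w)‖ = ‖w * a‖ := by rw [sub_eq_zero.1 h]
    rw [norm_smul, norm_mul, norm_mul, Real.norm_ofNat] at h1
    have ha' : 0 < ‖a‖ := norm_pos_iff.2 ha
    have h2 : ‖w‖ * ‖a‖ = 0 := by nlinarith [norm_nonneg w]
    rcases mul_eq_zero.1 h2 with h3 | h3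
    · exact norm_eq_zero.1 h3
    · exact absurd h3 ha'.ne'
  refine ⟨m, T 1, ⟨?_, ?_⟩, ?_⟩
  · -- regularity (Yang p. 578): left and right multiplications by `a ≠ 0` are bijective
    intro a ha
    have ha' : T.symm a ≠ 0 := by simpa using ha
    constructor
    · have hlin : (fun v => m v a) = T ∘ (μ.flip (T.symm a)) ∘ T.symm := by
        funext v; simp [hmapp', hμapp, LinearMap.flip_apply]
      rw [hlin]
      have hinj : Function.Injective (μ.flip (T.symm a)) := by
        refine (injective_iff_map_eq_zero _).2 fun v hv => ?_
        exact key _ _ ha' (by simpa [hμapp, LinearMap.flip_apply] using hv)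
      exact Function.Bijective.comp T.bijective
        (Function.Bijective.comp ⟨hinj, LinearMap.injective_iff_surjective.1 hinj⟩
          T.symm.bijective)
    · have hlin : (fun w => m a w) = T ∘ (μ (T.symm a)) ∘ T.symm := by
        funext w; simp [hmapp', hμapp]
      rw [hlin]
      have hinj : Function.Injective (μ (T.symm a)) := by
        refine (injective_iff_map_eq_zero _).2 fun w hw => ?_
        exact key' _ _ ha' (by simpa [hμapp] using hw)
      exact Function.Bijective.comp T.bijective
        (Function.Bijective.comp ⟨hinj, LinearMap.injective_iff_surjective.1 hinj⟩
          T.symm.bijective)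
  · -- `T 1` is a two-sided identity
    intro v
    constructor <;> (rw [hmapp']; simp [two_smul])
  · -- the witnesses: `u' = j`, `w₁ = i`, `w₂ = j`, `v₁ = k/3`, `v₂ = 1`, `v₁₂ = 1/2 + k/6`,
    -- `z₁ = -3k`, `z₂ = 1`, `z₁₂ = 9/5 - 3k/5`
    refine ⟨T ⟨0, 0, 1, 0⟩, T ⟨0, 1, 0, 0⟩, T ⟨0, 0, 1, 0⟩, T ⟨0, 0, 0, 1/3⟩, T 1, T ⟨1/2, 0, 0, 1/6⟩,
      T ⟨0, 0, 0, -3⟩, T 1, T ⟨9/5, 0, 0, -3/5⟩, ?_, ?_, ?_, ?_, ?_, ?_, ?_, ?_, ?_, ?_, ?_⟩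
    · rw [T.map_ne_zero_iff]; intro h; have h' := congrArg QuaternionAlgebra.imJ h; simp at h'
    · rw [T.map_ne_zero_iff]; intro h; have h' := congrArg QuaternionAlgebra.imI h; simp at h'
    · rw [T.map_ne_zero_iff]; intro h; have h' := congrArg QuaternionAlgebra.imJ h; simp at h'
    · rw [← map_add, T.map_ne_zero_iff]; intro h
      have h' := congrArg QuaternionAlgebra.imI h; simp at h'
    · rw [hmapp]; congr 1; ext <;> norm_num
    · rw [hmapp]; congr 1; ext <;> norm_num
    · rw [hmapp]; congr 1; ext <;> norm_num
    · rw [hmapp]; congr 1; ext <;> norm_num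
    · rw [← map_add, hmapp]; congr 1; ext <;> norm_num
    · rw [hmapp]; congr 1; ext <;> norm_num
    · rw [← map_add]; intro h
      have h' := congrArg QuaternionAlgebra.re (T.injective h); simp at h'; norm_num at h'

end MutationCounterexample

end Literature.Geometry.Riemannian

end
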